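import Literature.Geometry.Manifold.ProperSubmersionLocalTrivialisation
import HarnessLib

/-!
# Local `C^∞` triviality of a proper submersion, with the base coordinate (Ehresmann)

Topic `Literature/Geometry/Manifold`. Theorems only, no new facts. This is the tree's
`exists_localTrivialisation_of_surjective_mfderiv` (file `ProperSubmersionLocalTrivialisation`,
Bröcker–Jänich (1982), (8.12); Voisin (2002), Thm. 9.3 / Prop. 9.5) with the pieces of its
construction that deformation theory consumes made part of the statement
(`exists_localTrivialisation_translate`): besides the open tube `W ⊇ π⁻¹(s₀)` and the jointly
`C^∞`, mutually inverse, `W`-preserving maps `Tr, Sr : ℝᵈ × T → T` with `Tr (0, ·) = id`, we record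

* the base neighbourhood `V ∋ s₀`, open, `V ⊆ O`, inside the chart domain of `s₀`, with
  `W = π⁻¹(V)`;
* the base coordinate `τ : B → ℝᵈ`: `C^∞` and injective on `V`, `τ s₀ = 0`;
* the TRANSLATION LAW `τ (π (Tr (u, y))) = τ (π y) + u` for all `u ∈ ℝᵈ`, `y ∈ W` — the
  diffeomorphism `Tr (u, ·)` carries the fibre over `s` to the fibre over `τ⁻¹(τ s + u)`; in
  particular `(u, x) ↦ Tr (u, x)` on `ℝᵈ × π⁻¹(s₀)` is the differentiable trivialisation of
  Kodaira (2005), Thm. 2.5 / Voisin (2002), Prop. 9.5, and for any map `ψ₀` onto the central fibre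
  the family `Ψ_u = Tr (u, ψ₀ ·)` satisfies `τ ∘ π ∘ Ψ_u = u`.

The proof is that of the tree's theorem verbatim (chart `c` at `s₀`, a chart ball identified with
`ℝᵈ` by `univBall`, the global theorem `exists_contMDiff_trivialisation_of_surjective_mfderiv`
over `ℝᵈ` on the open submanifold `W`, `τ = univBall⁻¹ ∘ L ∘ c`); only the conclusion is longer.

## References

* T. Bröcker, K. Jänich, *Introduction to Differential Topology*, CUP 1982, (8.12).
  [BrockerJanichIDT1982]
* K. Kodaira, *Complex Manifolds and Deformation of Complex Structures* (2005), §2.3 Thm. 2.5.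
  [Kodaira2005]
* C. Voisin, *Hodge Theory and Complex Algebraic Geometry I*, CUP 2002, Thm. 9.3, Prop. 9.5.
  [VoisinHodgeI2002]
-/

noncomputable section

open scoped Manifold ContDiff Topology
open Set Function Filter Metric OpenPartialHomeomorph

namespace Literature.Geometry.Manifold

universe u v w

variable {ET : Type u} [NormedAddCommGroup ET] [NormedSpace ℝ ET] [FiniteDimensional ℝ ET]
  {HT : Type v} [TopologicalSpace HT] {IT : ModelWithCorners ℝ ET HT} [IT.Boundaryless]
  {T : Type w} [TopologicalSpace T] [ChartedSpace HT T] [IsManifold IT ∞ T] [T2Space T]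
  [SecondCountableTopology T]
  {EB : Type*} [NormedAddCommGroup EB] [NormedSpace ℝ EB] [FiniteDimensional ℝ EB]
  {B : Type*} [TopologicalSpace B] [ChartedSpace EB B] [IsManifold 𝓘(ℝ, EB) ∞ B]

/-- **Local `C^∞` triviality of a proper submersion near a fibre, with the base coordinate and the
translation law** (Ehresmann; Bröcker–Jänich (1982), (8.12); Kodaira (2005), Thm. 2.5; Voisin
(2002), Thm. 9.3 / Prop. 9.5). See the module docstring. [cite: BrockerJanichIDT1982, (8.12)]
[cite: Kodaira2005, §2.3 Thm. 2.5] -/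
theorem exists_localTrivialisation_translate {π : T → B}
    (hπ : ContMDiff IT 𝓘(ℝ, EB) ∞ π) {s₀ : B} {O : Set B} (hO : IsOpen O) (hs₀ : s₀ ∈ O)
    (hsub : ∀ x, π x ∈ O → Surjective (mfderiv IT 𝓘(ℝ, EB) π x))
    (hprop : ∀ K ⊆ O, IsCompact K → IsCompact (π ⁻¹' K)) :
    ∃ (V : Set B) (W : Set T) (τ : B → EuclideanSpace ℝ (Fin (Module.finrank ℝ EB)))
      (Tr Sr : EuclideanSpace ℝ (Fin (Module.finrank ℝ EB)) × T → T),
      IsOpen V ∧ s₀ ∈ V ∧ V ⊆ O ∧ V ⊆ (chartAt EB s₀).source ∧ W = π ⁻¹' V ∧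
      ContMDiffOn 𝓘(ℝ, EB) 𝓘(ℝ, EuclideanSpace ℝ (Fin (Module.finrank ℝ EB))) ∞ τ V ∧
      InjOn τ V ∧ τ s₀ = 0 ∧
      ContMDiffOn (𝓘(ℝ, EuclideanSpace ℝ (Fin (Module.finrank ℝ EB))).prod IT) IT ∞ Tr
        (univ ×ˢ W) ∧
      ContMDiffOn (𝓘(ℝ, EuclideanSpace ℝ (Fin (Module.finrank ℝ EB))).prod IT) IT ∞ Sr
        (univ ×ˢ W) ∧
      (∀ u, ∀ y ∈ W, Tr (u, y) ∈ W) ∧ (∀ u, ∀ y ∈ W, Sr (u, y) ∈ W) ∧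
      (∀ u, ∀ y ∈ W, Sr (u, Tr (u, y)) = y) ∧ (∀ u, ∀ y ∈ W, Tr (u, Sr (u, y)) = y) ∧
      (∀ y ∈ W, Tr (0, y) = y) ∧
      ∀ u, ∀ y ∈ W, τ (π (Tr (u, y))) = τ (π y) + u := by
  classical
  set d := Module.finrank ℝ EB with hd
  -- linear identification `E_B ≅ ℝᵈ` and the chart of `B` at `s₀`
  set L : EB ≃L[ℝ] EuclideanSpace ℝ (Fin d) :=
    ContinuousLinearEquiv.ofFinrankEq (by rw [finrank_euclideanSpace_fin]) with hL
  set c := extChartAt 𝓘(ℝ, EB) s₀ with hc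
  have hs₀c : s₀ ∈ c.source := mem_extChartAt_source s₀
  have hcsrc : c.source = (chartAt EB s₀).source := extChartAt_source (I := 𝓘(ℝ, EB)) s₀
  set p₀ : EuclideanSpace ℝ (Fin d) := L (c s₀) with hp₀
  -- a chart ball over which everything happens
  have hG : IsOpen (c.target ∩ c.symm ⁻¹' O) :=
    (continuousOn_extChartAt_symm s₀).isOpen_inter_preimage (isOpen_extChartAt_target s₀) hO
  have hG₀ : c s₀ ∈ c.target ∩ c.symm ⁻¹' O :=
    ⟨c.map_source hs₀c, by rw [mem_preimage, c.left_inv hs₀c]; exact hs₀⟩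
  obtain ⟨ρ, hρ, hball⟩ : ∃ ρ > 0, ball p₀ ρ ⊆ L.symm ⁻¹' (c.target ∩ c.symm ⁻¹' O) := by
    have hopen : IsOpen (L.symm ⁻¹' (c.target ∩ c.symm ⁻¹' O)) := hG.preimage L.symm.continuous
    have hmem : p₀ ∈ L.symm ⁻¹' (c.target ∩ c.symm ⁻¹' O) := by
      rw [mem_preimage, hp₀, L.symm_apply_apply]; exact hG₀
    exact Metric.isOpen_iff.1 hopen p₀ hmem
  -- the base neighbourhood `V` and the tube `W = π⁻¹ V`
  set V : Set B := c.source ∩ (fun s ↦ L (c s)) ⁻¹' ball p₀ ρ with hV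
  have hVopen : IsOpen V := by
    refine ((L.continuous.comp_continuousOn (continuousOn_extChartAt s₀)).isOpen_inter_preimage
      ?_ isOpen_ball)
    rw [hcsrc]; exact (chartAt EB s₀).open_source
  have hs₀V : s₀ ∈ V := ⟨hs₀c, by simp [hp₀, hρ]⟩
  have hVO : V ⊆ O := by
    rintro s ⟨hs, hsb⟩
    have := hball hsb
    rw [mem_preimage, L.symm_apply_apply] at this
    simpa [c.left_inv hs] using this.2
  have hVtarget : ∀ s ∈ V, c s ∈ c.target := fun s hs ↦ c.map_source hs.1
  set W : Set T := π ⁻¹' V with hW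
  have hWopen : IsOpen W := hVopen.preimage hπ.continuous
  let Wo : TopologicalSpace.Opens T := ⟨W, hWopen⟩
  -- the submersion `g = univBall⁻¹ ∘ L ∘ c ∘ π : W → ℝᵈ`
  set ub := univBall p₀ ρ with hub
  have hubt : ub.target = ball p₀ ρ := univBall_target p₀ hρ
  set e : B → EuclideanSpace ℝ (Fin d) := fun s ↦ ub.symm (L (c s)) with he
  set g : Wo → EuclideanSpace ℝ (Fin d) := fun y ↦ e (π y.1) with hgdef
  have hπW : ∀ y : Wo, π y.1 ∈ V := fun y ↦ y.2
  -- smoothness of `e` on `V` and of `g`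
  have he_smooth : ContMDiffOn 𝓘(ℝ, EB) 𝓘(ℝ, EuclideanSpace ℝ (Fin d)) ∞ e V := by
    have h1 : ContMDiffOn 𝓘(ℝ, EB) 𝓘(ℝ, EB) ∞ c V := by
      refine (contMDiffOn_extChartAt (n := ∞) (x := s₀)).mono ?_
      rw [← hcsrc]; exact inter_subset_left
    have h2 : ContMDiffOn 𝓘(ℝ, EB) 𝓘(ℝ, EuclideanSpace ℝ (Fin d)) ∞ (fun s ↦ L (c s)) V :=
      L.contDiff.contMDiff.comp_contMDiffOn h1
    have h3 : ContMDiffOn 𝓘(ℝ, EuclideanSpace ℝ (Fin d)) 𝓘(ℝ, EuclideanSpace ℝ (Fin d)) ∞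
        ub.symm (ball p₀ ρ) := contDiffOn_univBall_symm.contMDiffOn
    exact h3.comp h2 fun s hs ↦ hs.2
  have hg_smooth : ContMDiff IT 𝓘(ℝ, EuclideanSpace ℝ (Fin d)) ∞ g :=
    he_smooth.comp_contMDiff (hπ.comp contMDiff_subtype_val) hπW
  -- `g` is a submersion
  have hg_surj : ∀ y : Wo, Surjective (mfderiv IT 𝓘(ℝ, EuclideanSpace ℝ (Fin d)) g y) := by
    intro y
    have hyV := hπW y
    have hval : HasMFDerivAt IT IT (Subtype.val : Wo → T) y (ContinuousLinearMap.id ℝ ET) :=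
      OpenSubmanifold.hasMFDerivAt_subtype_val y
    have hπd : HasMFDerivAt IT 𝓘(ℝ, EB) π y.1 (mfderiv IT 𝓘(ℝ, EB) π y.1) :=
      (hπ.mdifferentiableAt (by simp)).hasMFDerivAt
    have hcd : HasMFDerivAt 𝓘(ℝ, EB) 𝓘(ℝ, EB) c (π y.1) (mfderiv 𝓘(ℝ, EB) 𝓘(ℝ, EB) c (π y.1)) :=
      (mdifferentiableAt_extChartAt (by rw [← hcsrc]; exact hyV.1)).hasMFDerivAt
    have hLd : HasMFDerivAt 𝓘(ℝ, EB) 𝓘(ℝ, EuclideanSpace ℝ (Fin d)) L (c (π y.1))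
        (L : EB →L[ℝ] EuclideanSpace ℝ (Fin d)) :=
      L.hasFDerivAt.hasMFDerivAt
    have hpball : L (c (π y.1)) ∈ ball p₀ ρ := hyV.2
    have hubd : HasMFDerivAt 𝓘(ℝ, EuclideanSpace ℝ (Fin d)) 𝓘(ℝ, EuclideanSpace ℝ (Fin d))
        ub.symm (L (c (π y.1))) (fderiv ℝ ub.symm (L (c (π y.1)))) :=
      ((((contDiffOn_univBall_symm (n := 1)).differentiableOn (by simp)).differentiableAt
        (isOpen_ball.mem_nhds hpball)).hasFDerivAt).hasMFDerivAt
    have hcomp : HasMFDerivAt IT 𝓘(ℝ, EuclideanSpace ℝ (Fin d)) g y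
        ((fderiv ℝ ub.symm (L (c (π y.1)))).comp ((L : EB →L[ℝ] EuclideanSpace ℝ (Fin d)).comp
          ((mfderiv 𝓘(ℝ, EB) 𝓘(ℝ, EB) c (π y.1)).comp
            ((mfderiv IT 𝓘(ℝ, EB) π y.1).comp (ContinuousLinearMap.id ℝ ET))))) :=
      hubd.comp y (hLd.comp y (hcd.comp y (hπd.comp y hval)))
    rw [hcomp.mfderiv]
    refine (surjective_fderiv_univBall_symm p₀ hρ hpball).comp (L.surjective.comp ?_)
    refine (isInvertible_mfderiv_extChartAt (by exact hyV.1)).surjective.comp ?_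
    intro v
    obtain ⟨w, hw⟩ := hsub y.1 (hVO hyV) v
    exact ⟨w, hw⟩
  -- preimages of closed balls are compact
  have hg_proper : ∀ (u : EuclideanSpace ℝ (Fin d)) (R : ℝ), IsCompact (g ⁻¹' closedBall u R) := by
    intro u R
    set K₁ := ub '' closedBall u R with hK₁
    have hK₁c : IsCompact K₁ := (isCompact_closedBall u R).image (contDiff_univBall (n := 1)).continuous
    have hK₁ball : K₁ ⊆ ball p₀ ρ := by
      rintro _ ⟨z, -, rfl⟩
      rw [← hubt]; exact ub.map_source (by simp [hub, univBall_source])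
    set K₂ := L.symm '' K₁ with hK₂
    have hK₂c : IsCompact K₂ := hK₁c.image L.symm.continuous
    have hK₂G : K₂ ⊆ c.target ∩ c.symm ⁻¹' O := by
      rintro _ ⟨p, hp, rfl⟩; exact hball (hK₁ball hp)
    set K₃ := c.symm '' K₂ with hK₃
    have hK₃c : IsCompact K₃ :=
      hK₂c.image_of_continuousOn ((continuousOn_extChartAt_symm s₀).mono fun p hp ↦ (hK₂G hp).1)
    have hK₃O : K₃ ⊆ O := by
      rintro _ ⟨p, hp, rfl⟩; exact (hK₂G hp).2
    have hK₃V : K₃ ⊆ V := by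
      rintro _ ⟨p, hp, rfl⟩
      obtain ⟨q, hq, rfl⟩ := hp
      refine ⟨c.map_target (hK₂G ⟨q, hq, rfl⟩).1, ?_⟩
      show L (c (c.symm (L.symm q))) ∈ ball p₀ ρ
      rw [c.right_inv (hK₂G ⟨q, hq, rfl⟩).1, L.apply_symm_apply]
      exact hK₁ball hq
    have hpre : g ⁻¹' closedBall u R = (Subtype.val : Wo → T) ⁻¹' (π ⁻¹' K₃) := by
      ext y
      simp only [mem_preimage]
      have hyV := hπW y
      have hct : c (π y.1) ∈ c.target := hVtarget _ hyV
      constructor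
      · intro hy
        have h1 : ub (g y) = L (c (π y.1)) := ub.right_inv (by rw [hubt]; exact hyV.2)
        refine ⟨c (π y.1), ⟨ub (g y), ⟨g y, hy, rfl⟩, by rw [h1, L.symm_apply_apply]⟩,
          c.left_inv hyV.1⟩
      · rintro ⟨p, ⟨q, ⟨z, hz, rfl⟩, rfl⟩, hpy⟩
        have h1 : c (π y.1) = L.symm (ub z) := by
          rw [← hpy, c.right_inv (hK₂G ⟨ub z, ⟨z, hz, rfl⟩, rfl⟩).1]
        show ub.symm (L (c (π y.1))) ∈ closedBall u R
        rw [h1, L.apply_symm_apply, ub.left_inv (by simp [hub, univBall_source])]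
        exact hz
    rw [hpre, Topology.IsInducing.subtypeVal.isCompact_iff]
    convert hprop K₃ hK₃O hK₃c using 1
    ext x
    constructor
    · rintro ⟨y, hy, rfl⟩; exact hy
    · intro hx; exact ⟨⟨x, show π x ∈ V from hK₃V hx⟩, hx, rfl⟩
  -- the global theorem over `ℝᵈ` on the open submanifold `W`
  obtain ⟨T', S', hT', hS', hST, hTS, hT0, hgT⟩ :=
    exists_contMDiff_trivialisation_of_surjective_mfderiv hg_smooth hg_surj hg_proper
  -- extend by the identity outside `W`
  let Tr : EuclideanSpace ℝ (Fin d) × T → T := fun p ↦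
    if h : p.2 ∈ W then (T' (p.1, ⟨p.2, h⟩) : T) else p.2
  let Sr : EuclideanSpace ℝ (Fin d) × T → T := fun p ↦
    if h : p.2 ∈ W then (S' (p.1, ⟨p.2, h⟩) : T) else p.2
  have hTr : ∀ u, ∀ y (hy : y ∈ W), Tr (u, y) = T' (u, ⟨y, hy⟩) := fun u y hy ↦ dif_pos hy
  have hSr : ∀ u, ∀ y (hy : y ∈ W), Sr (u, y) = S' (u, ⟨y, hy⟩) := fun u y hy ↦ dif_pos hy
  -- smoothness on `ℝᵈ × W`
  have hsmooth : ∀ {F : EuclideanSpace ℝ (Fin d) × Wo → Wo},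
      ContMDiff (𝓘(ℝ, EuclideanSpace ℝ (Fin d)).prod IT) IT ∞ F →
      ∀ (Fr : EuclideanSpace ℝ (Fin d) × T → T),
        (∀ u, ∀ y (hy : y ∈ W), Fr (u, y) = F (u, ⟨y, hy⟩)) →
        ContMDiffOn (𝓘(ℝ, EuclideanSpace ℝ (Fin d)).prod IT) IT ∞ Fr (univ ×ˢ W) := by
    intro F hF Fr hFr
    rintro ⟨u, y⟩ ⟨-, hy⟩
    -- work on the open submanifold `ℝᵈ × W` of `ℝᵈ × T`
    let Wp : TopologicalSpace.Opens (EuclideanSpace ℝ (Fin d) × T) :=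
      ⟨univ ×ˢ W, isOpen_univ.prod hWopen⟩
    have hq : ContMDiff ((𝓘(ℝ, EuclideanSpace ℝ (Fin d))).prod IT)
        ((𝓘(ℝ, EuclideanSpace ℝ (Fin d))).prod IT) ∞
        (fun p : Wp ↦ ((p.1.1, ⟨p.1.2, p.2.2⟩) : EuclideanSpace ℝ (Fin d) × Wo)) := by
      refine ContMDiff.prodMk ?_ ?_
      · exact contMDiff_fst.comp contMDiff_subtype_val
      · rw [← ContMDiff.subtypeVal_comp_iff]
        exact contMDiff_snd.comp contMDiff_subtype_val
    have hcompW : ContMDiff ((𝓘(ℝ, EuclideanSpace ℝ (Fin d))).prod IT) IT ∞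
        (fun p : Wp ↦ Fr p.1) := by
      have : (fun p : Wp ↦ Fr p.1) =
          Subtype.val ∘ F ∘ (fun p : Wp ↦ ((p.1.1, ⟨p.1.2, p.2.2⟩) : _ × Wo)) := by
        funext p
        obtain ⟨⟨u', y'⟩, -, hy'⟩ := p
        exact hFr u' y' hy'
      rw [this]
      exact contMDiff_subtype_val.comp (hF.comp hq)
    have hat : ContMDiffAt ((𝓘(ℝ, EuclideanSpace ℝ (Fin d))).prod IT) IT ∞ Fr (u, y) :=
      (contMDiffAt_subtype_iff (U := Wp) (x := ⟨(u, y), mem_univ _, hy⟩)).1 hcompW.contMDiffAt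
    exact hat.contMDiffWithinAt
  -- the parameter of the fibres
  set τ : B → EuclideanSpace ℝ (Fin d) := e with hτ
  have he₀ : e s₀ = 0 := by
    show ub.symm (L (c s₀)) = 0
    rw [← hp₀]; exact univBall_symm_apply_center p₀ ρ
  have hg_fibre : ∀ y : Wo, g y = 0 ↔ π y.1 = s₀ := by
    intro y
    constructor
    · intro hy
      have hyV := hπW y
      have h1 : L (c (π y.1)) = p₀ := by
        have := ub.right_inv (show L (c (π y.1)) ∈ ub.target by rw [hubt]; exact hyV.2)
        rw [show ub.symm (L (c (π y.1))) = 0 from hy, univBall_apply_zero] at this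
        exact this.symm
      have h2 : c (π y.1) = c s₀ := L.injective (by rw [h1, hp₀])
      exact c.injOn hyV.1 hs₀c h2
    · intro hy
      show e (π y.1) = 0
      rw [hy, he₀]
  have hτinj : InjOn τ V := by
    intro s hs s' hs' h
    have a := ub.right_inv (show L (c s) ∈ ub.target by rw [hubt]; exact hs.2)
    have b := ub.right_inv (show L (c s') ∈ ub.target by rw [hubt]; exact hs'.2)
    have h1 : L (c s) = L (c s') := by
      rw [← a, ← b]
      exact congrArg ub h
    exact c.injOn hs.1 hs'.1 (L.injective h1)
  refine ⟨V, W, τ, Tr, Sr, hVopen, hs₀V, hVO, ?_, rfl, he_smooth, hτinj, he₀, hsmooth hT' Tr hTr,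
    hsmooth hS' Sr hSr, ?_, ?_, ?_, ?_, ?_, ?_⟩
  · rw [← hcsrc]; exact inter_subset_left
  · intro u y hy; rw [hTr u y hy]; exact (T' _).2
  · intro u y hy; rw [hSr u y hy]; exact (S' _).2
  · intro u y hy
    rw [hTr u y hy, hSr u _ (T' _).2]
    simpa using congrArg Subtype.val (hST u ⟨y, hy⟩)
  · intro u y hy
    rw [hSr u y hy, hTr u _ (S' _).2]
    simpa using congrArg Subtype.val (hTS u ⟨y, hy⟩)
  · intro y hy
    rw [hTr 0 y hy]
    simpa using congrArg Subtype.val (hT0 ⟨y, hy⟩)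
  · intro u y hy
    rw [hTr u y hy]
    exact hgT u ⟨y, hy⟩

end Literature.Geometry.Manifold
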